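import Literature.NumberTheory.Automorphic.ArchKirillovSignsGL2Real
import Literature.NumberTheory.Automorphic.ArchKirillovODEGL2Complex
import Literature.NumberTheory.Automorphic.ArchKirillovFunctionGL2
import Literature.NumberTheory.Automorphic.MixedSpaceUnitsIntegration
import HarnessLib

/-!
# The torus `diag(u, 1)`, `u ∈ K_∞ˣ`, of `GL₂(K_∞)` in place coordinates

Topic `NumberTheory/Automorphic`; namespace `Literature.NumberTheory.Automorphic`. Theorems only (no
definition, no named fact, no instance). Bookkeeping for the archimedean Hecke integral
`∫_{K_∞ˣ} W_e(diag(u,1)) N(u)^{s-1/2} d^×u` of a Gårding vector `e` of `GL₂(K_∞)`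
(`kirillovFn hτ ℓ e u = ℓ(τ(diag(u,1)) e)`), connecting the GLOBAL torus element `diagGL2 u 1` with the
one-parameter subgroups of the single places in which the Kirillov functions were computed
(`ArchKirillovODEGL2Real` &c.: `exp(y H₀^w)`, the sign `δ_w`; `ArchKirillovODEGL2Complex` &c.:
`exp(y E₀₀ ⊗ c_w)`, `exp(t E₀₀ ⊗ ic_w)`):

* `coe_diagGL2_one`, `diagGL2_one_mul`, `diagGL2_one_comm`, `kirillovFn_eq_apply_gardingAct` —
  `diag(u,1) = 1 + E₀₀ ⊗ (u - 1)`, multiplicativity and commutativity in `u`;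
* `diagGL2_realUnitAt_of_pos` — **`diag(x_w, 1) = exp((log x) H₀^w)`** for the coordinate unit `x > 0` of a
  real place `w` (`realUnitAt`), and `diagGL2_realUnitAt_of_neg` — **`= exp((log |x|) H₀^w) δ_w`** for `x < 0`
  (`δ_w = 1 - 2H₀^w`);
* `diagGL2_complexUnitAt` — **`diag(z_w, 1) = exp((log |z|) E₀₀ ⊗ c_w) · exp((arg z) E₀₀ ⊗ ic_w)`** for the
  coordinate unit `z` of a complex place (`complexUnitAt`; `exp(t E₀₀ ⊗ ic_w) = 1 + E₀₀ ⊗ (e^{it} - 1)c_w`,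
  `coe_expGL_smul_single_complexIdemI`);
* `kirillovFn_eq_realUnitAt`, `kirillovFn_eq_complexUnitAt` — `W_e(diag(u,1)) = ℓ(τ(diag(u_w,1)) τ(diag(u^{(w)},1)) e)`
  with `u^{(w)} = u · (u_w)⁻¹` the unit with the `w`-coordinate reset to `1` (`unitsFstAt`, `unitsSndAt`),
  and the coordinates of `u^{(w)}` (`coe_mul_realUnitAt_inv`, `coe_mul_complexUnitAt_inv`);
* `conj_single_realIdem_eq`, `conj_single_complexIdem_eq` — **`Ad(diag(u',1))` fixes the
  letters `E_{ij} ⊗ x` of the place `w` whenever `u'_w = 1`** (`u' r_w = r_w`, `x r_w = x`), so that the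
  weight / Casimir / raising conditions at `w` of a vector are inherited by its translates under the torus
  of the other places.

## References

* H. Jacquet, R. P. Langlands, *Automorphic Forms on GL(2)*, LNM 114 (1970), §5–§6, and proof of Thm. 11.1
  (p. 173: the archimedean integral is the product of the integrals of the single places). [JacquetLanglands1970]
* J. Tate, *Fourier analysis in number fields and Hecke's zeta-functions* (1967), §4.3 (`K_∞ˣ = ∏_v K_vˣ`).
  [TateThesis1967]
-/

noncomputable section

open MeasureTheory Measure NumberField NumberField.InfinitePlace NumberField.mixedEmbedding IsDedekindDomain Set Filter
open scoped MatrixGroups Topology Classical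

namespace Literature.NumberTheory.Automorphic

variable {K : Type} [Field K] [NumberField K]

-- as in `ArchGardingWhittaker`
set_option backward.isDefEq.respectTransparency false

/-! ### 1. `diag(u, 1)` -/

section Diag

variable {R : Type*} [CommRing R] [TopologicalSpace R]

omit [TopologicalSpace R] in
/-- `diag(u, 1) = 1 + E₀₀ ⊗ (u - 1)`. [folklore] -/
theorem coe_diagGL2_one (u : Rˣ) :
    ((diagGL2 u 1 : GL (Fin 2) R) : Matrix (Fin 2) (Fin 2) R) = 1 + Matrix.single 0 0 ((u : R) - 1) := by
  rw [coe_diagGL2]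
  ext i j
  fin_cases i <;> fin_cases j <;> simp [Matrix.single]

omit [TopologicalSpace R] in
/-- `diag(uu', 1) = diag(u, 1) diag(u', 1)`. [folklore] -/
theorem diagGL2_one_mul (u u' : Rˣ) : (diagGL2 (u * u') 1 : GL (Fin 2) R) = diagGL2 u 1 * diagGL2 u' 1 := by
  rw [← diagGL2_mul, mul_one]

omit [TopologicalSpace R] in
/-- The `diag(u, 1)` commute. [folklore] -/
theorem diagGL2_one_comm (u u' : Rˣ) : (diagGL2 u 1 : GL (Fin 2) R) * diagGL2 u' 1 = diagGL2 u' 1 * diagGL2 u 1 := by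
  rw [← diagGL2_one_mul, ← diagGL2_one_mul, mul_comm]

omit [TopologicalSpace R] in
/-- `(1 + E₀₀ ⊗ a)(1 + E₀₀ ⊗ b) = 1 + E₀₀ ⊗ (a + b + ab)`. [folklore] -/
theorem one_add_single_mul_one_add_single (a b : R) :
    ((1 : Matrix (Fin 2) (Fin 2) R) + Matrix.single 0 0 a) * (1 + Matrix.single 0 0 b) =
      1 + Matrix.single 0 0 (a + b + a * b) := by
  rw [add_mul, mul_add, mul_add, one_mul, mul_one, one_mul, Matrix.single_mul_single_same, Matrix.single_add,
    Matrix.single_add]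
  abel

end Diag

/-! ### 2. The Kirillov function through `gardingAct` -/

section Kirillov

variable {hcpt : isCompact_glFiniteIntegralLevel 2 K}
  {E : Type*} [NormedAddCommGroup E] [NormedSpace ℂ E] [CompleteSpace E]
  {τ : ContRepresentation ℂ (AutomorphyDatum.gl 2 K hcpt).arch.carrier E}

/-- `W_e(diag(u,1)) = ℓ(τ(diag(u,1)) e)` with the torus acting through `gardingAct`. [folklore] -/
theorem kirillovFn_eq_apply_gardingAct (hτ : τ.IsStronglyContinuous) (ℓ : archGardingSpace hcpt τ →ₗ[ℂ] ℂ)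
    (e : archGardingSpace hcpt τ) (u : (mixedSpace K)ˣ) :
    kirillovFn hτ ℓ e u = ℓ (gardingAct hτ (diagGL2 u 1) e) := rfl

/-- Splitting off a factor of the torus: `W_e(diag(uu',1)) = ℓ(τ(diag(u',1)) τ(diag(u,1)) e)`. [folklore] -/
theorem kirillovFn_mul (hτ : τ.IsStronglyContinuous) (ℓ : archGardingSpace hcpt τ →ₗ[ℂ] ℂ)
    (e : archGardingSpace hcpt τ) (u u' : (mixedSpace K)ˣ) :
    kirillovFn hτ ℓ e (u * u') = ℓ (gardingAct hτ (diagGL2 u' 1) (gardingAct hτ (diagGL2 u 1) e)) := by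
  rw [kirillovFn_eq_apply_gardingAct, diagGL2_one_mul, diagGL2_one_comm, gardingAct_mul, Module.End.mul_apply]

end Kirillov

/-! ### 3. Real coordinates -/

section RealCoord

variable (w : {w : InfinitePlace K // IsReal w})


omit [NumberField K] in
/-- The value of the coordinate unit `realUnitAt K w x` in `K_∞`. [folklore] -/
theorem coe_realUnitAt (x : ℝˣ) :
    ((realUnitAt K w x : (mixedSpace K)ˣ) : mixedSpace K) = (Pi.mulSingle w (x : ℝ), 1) := by
  simp only [Units.coe_map, MonoidHom.coe_comp, Function.comp_apply, MonoidHom.mulSingle_apply, MonoidHom.inl_apply]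

omit [NumberField K] in
/-- `realUnitAt K w x - 1 = (x - 1) r_w` in `K_∞`. [folklore] -/
theorem coe_realUnitAt_sub_one (x : ℝˣ) :
    ((realUnitAt K w x : (mixedSpace K)ˣ) : mixedSpace K) - 1 = ((x : ℝ) - 1) • ((Pi.single w 1, 0) : mixedSpace K) := by
  rw [coe_realUnitAt]
  refine Prod.ext (funext fun v => ?_) (funext fun v => ?_)
  · simp only [Prod.fst_sub, Pi.sub_apply, Prod.fst_one, Pi.one_apply, Prod.smul_fst, Pi.smul_apply, smul_eq_mul]
    by_cases hv : v = w
    · subst hv; simp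
    · simp [Pi.mulSingle, Function.update, hv]
  · simp

/-- **`diag(x_w, 1) = exp((log x) H₀^w)` for a positive real coordinate unit.** [folklore] -/
theorem diagGL2_realUnitAt_of_pos {x : ℝˣ} (hx : 0 < (x : ℝ)) :
    (diagGL2 (realUnitAt K w x) 1 : GL (Fin 2) (mixedSpace K)) = expGL ((Real.log x) • (Matrix.single (0 : Fin 2) (0 : Fin 2) ((Pi.single w 1, 0) : mixedSpace K))) := by
  refine Units.ext ?_
  rw [coe_diagGL2_one, coe_expGL_smul_hZero, Real.exp_log hx, coe_realUnitAt_sub_one, Matrix.smul_single]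

variable {w} {δ : GL (Fin 2) (mixedSpace K)}
  (hδ : (δ : Matrix (Fin 2) (Fin 2) (mixedSpace K)) = 1 - (2 : ℝ) • Matrix.single (0 : Fin 2) (0 : Fin 2) ((Pi.single w 1, 0) : mixedSpace K))
include hδ

/-- **`diag(x_w, 1) = exp((log |x|) H₀^w) δ_w` for a negative real coordinate unit** (`δ_w = 1 - 2H₀^w`). [folklore] -/
theorem diagGL2_realUnitAt_of_neg {x : ℝˣ} (hx : (x : ℝ) < 0) :
    (diagGL2 (realUnitAt K w x) 1 : GL (Fin 2) (mixedSpace K)) = expGL ((Real.log |(x : ℝ)|) • (Matrix.single (0 : Fin 2) (0 : Fin 2) ((Pi.single w 1, 0) : mixedSpace K))) * δ := by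
  refine Units.ext ?_
  rw [Units.val_mul, coe_diagGL2_one, coe_expGL_smul_hZero, Real.exp_log (abs_pos.2 hx.ne), hδ,
    coe_realUnitAt_sub_one, ← Matrix.smul_single]
  have e : (1 : Matrix (Fin 2) (Fin 2) (mixedSpace K)) - (2 : ℝ) • (Matrix.single (0 : Fin 2) (0 : Fin 2) ((Pi.single w 1, 0) : mixedSpace K)) = 1 + (-2 : ℝ) • (Matrix.single (0 : Fin 2) (0 : Fin 2) ((Pi.single w 1, 0) : mixedSpace K)) := by
    rw [neg_smul, sub_eq_add_neg]
  have h := one_add_smul_mul_mul_one_add_smul (Matrix.single (0 : Fin 2) (0 : Fin 2) ((Pi.single w 1, 0) : mixedSpace K)) (1 : Matrix (Fin 2) (Fin 2) (mixedSpace K)) (|(x : ℝ)| - 1) (-2)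
  rw [mul_one, mul_one, one_mul, (hZero_mul_letters (K := K) w).2.2.2.2.1] at h
  rw [e, h, abs_of_neg hx]
  module

end RealCoord

/-! ### 4. Complex coordinates -/

section ComplexCoord

variable (w : {w : InfinitePlace K // IsComplex w})


omit [NumberField K] in
/-- The value of the coordinate unit `complexUnitAt K w z` in `K_∞`. [folklore] -/
theorem coe_complexUnitAt (z : ℂˣ) :
    ((complexUnitAt K w z : (mixedSpace K)ˣ) : mixedSpace K) = (1, Pi.mulSingle w (z : ℂ)) := by
  simp only [Units.coe_map, MonoidHom.coe_comp, Function.comp_apply, MonoidHom.mulSingle_apply, MonoidHom.inr_apply]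

omit [NumberField K] in
/-- `complexUnitAt K w z - 1 = (0, (z - 1) 1_w)` in `K_∞`. [folklore] -/
theorem coe_complexUnitAt_sub_one (z : ℂˣ) :
    ((complexUnitAt K w z : (mixedSpace K)ˣ) : mixedSpace K) - 1 = ((0, Pi.single w ((z : ℂ) - 1)) : mixedSpace K) := by
  rw [coe_complexUnitAt]
  refine Prod.ext (funext fun v => ?_) (funext fun v => ?_)
  · simp
  · simp only [Prod.snd_sub, Pi.sub_apply, Prod.snd_one, Pi.one_apply]
    by_cases hv : v = w
    · subst hv; simp
    · simp [Pi.mulSingle, Function.update, hv]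

/-- **`exp(t ic_w) = 1 + (e^{it} - 1) c_w`** in `K_∞` (componentwise exponential). [folklore] -/
theorem exp_smul_complexIdemI (t : ℝ) :
    NormedSpace.exp (t • ((0, Pi.single w Complex.I) : mixedSpace K)) = 1 + ((0, Pi.single w (Complex.exp (t * Complex.I) - 1)) : mixedSpace K) := by
  refine Prod.ext ?_ ?_
  · have h1 : (NormedSpace.exp (t • ((0, Pi.single w Complex.I) : mixedSpace K))).1 = NormedSpace.exp ((t • ((0, Pi.single w Complex.I) : mixedSpace K)).1) :=
      Prod.fst_exp (𝔸 := {w : InfinitePlace K // IsReal w} → ℝ) (𝔹 := {w : InfinitePlace K // IsComplex w} → ℂ) _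
    rw [h1]
    simp [NormedSpace.exp_zero]
  · have h1 : (NormedSpace.exp (t • ((0, Pi.single w Complex.I) : mixedSpace K))).2 = NormedSpace.exp ((t • ((0, Pi.single w Complex.I) : mixedSpace K)).2) :=
      Prod.snd_exp (𝔸 := {w : InfinitePlace K // IsReal w} → ℝ) (𝔹 := {w : InfinitePlace K // IsComplex w} → ℂ) _
    rw [h1]
    funext v
    have h2 : NormedSpace.exp ((t • ((0, Pi.single w Complex.I) : mixedSpace K)).2) v = NormedSpace.exp ((t • ((0, Pi.single w Complex.I) : mixedSpace K)).2 v) :=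
      Pi.coe_exp (𝔸 := fun _ : {w : InfinitePlace K // IsComplex w} => ℂ) _ v
    rw [h2]
    simp only [Prod.smul_snd, Prod.snd_add, Prod.snd_one, Pi.smul_apply, Pi.add_apply, Pi.one_apply]
    by_cases hv : v = w
    · subst hv
      rw [congrFun Complex.exp_eq_exp_ℂ.symm]
      simp [Complex.real_smul]
    · simp [hv, NormedSpace.exp_zero]

/-- The same in `simp`-normal form. [folklore] -/
theorem exp_smul_complexIdemI' (t : ℝ) :
    NormedSpace.exp (((0 : {v : InfinitePlace K // IsReal v} → ℝ),
        t • (Pi.single w Complex.I : {v : InfinitePlace K // IsComplex v} → ℂ)) : mixedSpace K) =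
      (1 : mixedSpace K) + (((0 : {v : InfinitePlace K // IsReal v} → ℝ),
        (Pi.single w (Complex.exp (t * Complex.I) - 1) : {v : InfinitePlace K // IsComplex v} → ℂ)) : mixedSpace K) := by
  have h := exp_smul_complexIdemI (K := K) w t
  rw [Prod.smul_mk, smul_zero] at h
  exact h

/-- **`exp(t E₀₀ ⊗ ic_w) = 1 + E₀₀ ⊗ (e^{it} - 1) c_w`**: the rotation of the `w`-coordinate by `t`. [folklore] -/
theorem coe_expGL_smul_single_complexIdemI (t : ℝ) :
    ((expGL (t • Matrix.single (0 : Fin 2) (0 : Fin 2) ((0, Pi.single w Complex.I) : mixedSpace K)) : GL (Fin 2) (mixedSpace K)) : Matrix (Fin 2) (Fin 2) (mixedSpace K)) =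
      1 + Matrix.single 0 0 ((0, Pi.single w (Complex.exp (t * Complex.I) - 1)) : mixedSpace K) := by
  rw [coe_expGL, Matrix.smul_single, ← Matrix.diagonal_single, Matrix.exp_diagonal]
  refine Matrix.ext fun i j => ?_
  fin_cases i <;> fin_cases j
  · simp [Matrix.diagonal, Matrix.single, exp_smul_complexIdemI']
  · simp [Matrix.diagonal, Matrix.single]
  · simp [Matrix.diagonal, Matrix.single]
  · simp [Matrix.diagonal, Matrix.single, NormedSpace.exp_zero]

/-- **`diag(z_w, 1) = exp((log |z|) E₀₀ ⊗ c_w) · exp((arg z) E₀₀ ⊗ ic_w)` for a complex coordinate unit.** [folklore] -/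
theorem diagGL2_complexUnitAt (z : ℂˣ) :
    (diagGL2 (complexUnitAt K w z) 1 : GL (Fin 2) (mixedSpace K)) =
      expGL ((Real.log ‖(z : ℂ)‖) • (Matrix.single (0 : Fin 2) (0 : Fin 2) ((0, Pi.single w 1) : mixedSpace K))) * expGL ((Complex.arg z) • Matrix.single (0 : Fin 2) (0 : Fin 2) ((0, Pi.single w Complex.I) : mixedSpace K)) := by
  have hz : (z : ℂ) ≠ 0 := z.ne_zero
  refine Units.ext ?_
  rw [Units.val_mul, coe_diagGL2_one, coe_expGL_smul_hZeroC, Real.exp_log (norm_pos_iff.2 hz),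
    coe_expGL_smul_single_complexIdemI, coe_complexUnitAt_sub_one, Matrix.smul_single, one_add_single_mul_one_add_single]
  congr 2
  refine Prod.ext (by simp) (funext fun v => ?_)
  simp only [Prod.snd_add, Prod.snd_mul, Prod.smul_snd, Pi.add_apply, Pi.mul_apply, Pi.smul_apply]
  by_cases hv : v = w
  · subst hv
    simp only [Pi.single_eq_same, Complex.real_smul, mul_one]
    have h := Complex.norm_mul_exp_arg_mul_I (z : ℂ)
    push_cast
    linear_combination -h
  · simp [hv]

end ComplexCoord

/-! ### 5. Resetting one coordinate of a unit -/

section Reset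

/-- `diag(u,1) = diag(u (u_w)⁻¹, 1) · diag(u_w, 1)` for the real coordinate unit `u_w = realUnitAt (unitsFstAt u w)`,
through `gardingAct`: `W_e(diag(u,1)) = ℓ(τ(diag(u_w,1)) τ(diag(u^{(w)},1)) e)`. [folklore] -/
theorem kirillovFn_eq_realUnitAt {hcpt : isCompact_glFiniteIntegralLevel 2 K}
    {E : Type*} [NormedAddCommGroup E] [NormedSpace ℂ E] [CompleteSpace E]
    {τ : ContRepresentation ℂ (AutomorphyDatum.gl 2 K hcpt).arch.carrier E}
    (hτ : τ.IsStronglyContinuous) (ℓ : archGardingSpace hcpt τ →ₗ[ℂ] ℂ) (e : archGardingSpace hcpt τ)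
    (w : {w : InfinitePlace K // IsReal w}) (u : (mixedSpace K)ˣ) :
    kirillovFn hτ ℓ e u = ℓ (gardingAct hτ (diagGL2 (realUnitAt K w (unitsFstAt u w)) 1)
      (gardingAct hτ (diagGL2 (u * (realUnitAt K w (unitsFstAt u w))⁻¹) 1) e)) := by
  rw [← kirillovFn_mul, inv_mul_cancel_right]

/-- The same for a complex coordinate. [folklore] -/
theorem kirillovFn_eq_complexUnitAt {hcpt : isCompact_glFiniteIntegralLevel 2 K}
    {E : Type*} [NormedAddCommGroup E] [NormedSpace ℂ E] [CompleteSpace E]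
    {τ : ContRepresentation ℂ (AutomorphyDatum.gl 2 K hcpt).arch.carrier E}
    (hτ : τ.IsStronglyContinuous) (ℓ : archGardingSpace hcpt τ →ₗ[ℂ] ℂ) (e : archGardingSpace hcpt τ)
    (w : {w : InfinitePlace K // IsComplex w}) (u : (mixedSpace K)ˣ) :
    kirillovFn hτ ℓ e u = ℓ (gardingAct hτ (diagGL2 (complexUnitAt K w (unitsSndAt u w)) 1)
      (gardingAct hτ (diagGL2 (u * (complexUnitAt K w (unitsSndAt u w))⁻¹) 1) e)) := by
  rw [← kirillovFn_mul, inv_mul_cancel_right]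

omit [NumberField K] in
/-- The coordinates of `u (u_w)⁻¹` (real `w`): `1` at `w`, those of `u` elsewhere. [folklore] -/
theorem coe_mul_realUnitAt_inv (w : {w : InfinitePlace K // IsReal w}) (u : (mixedSpace K)ˣ) :
    ((u * (realUnitAt K w (unitsFstAt u w))⁻¹ : (mixedSpace K)ˣ) : mixedSpace K) =
      (Function.update (u : mixedSpace K).1 w 1, (u : mixedSpace K).2) := by
  rw [Units.val_mul, ← map_inv, coe_realUnitAt]
  refine Prod.ext (funext fun v => ?_) (funext fun v => ?_)
  · simp only [Prod.fst_mul, Pi.mul_apply]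
    by_cases hv : v = w
    · subst hv
      simp [Units.val_inv_eq_inv_val, units_fst_ne_zero]
    · simp [Pi.mulSingle, Function.update, hv]
  · simp

omit [NumberField K] in
/-- The coordinates of `u (u_w)⁻¹` (complex `w`). [folklore] -/
theorem coe_mul_complexUnitAt_inv (w : {w : InfinitePlace K // IsComplex w}) (u : (mixedSpace K)ˣ) :
    ((u * (complexUnitAt K w (unitsSndAt u w))⁻¹ : (mixedSpace K)ˣ) : mixedSpace K) =
      ((u : mixedSpace K).1, Function.update (u : mixedSpace K).2 w 1) := by
  rw [Units.val_mul, ← map_inv, coe_complexUnitAt]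
  refine Prod.ext (funext fun v => ?_) (funext fun v => ?_)
  · simp
  · simp only [Prod.snd_mul, Pi.mul_apply]
    by_cases hv : v = w
    · subst hv
      simp [Units.val_inv_eq_inv_val, units_snd_ne_zero]
    · simp [Pi.mulSingle, Function.update, hv]

end Reset

/-! ### 6. `Ad(diag(u', 1))` fixes the letters of a place where `u'` is trivial -/

section Conj

omit [NumberField K] in
/-- If `u' x = x` and `x u'⁻¹ = x` in `K_∞` then `diag(u',1) (E_{ij} ⊗ x) diag(u',1)⁻¹ = E_{ij} ⊗ x` for all
`i, j`. [folklore] -/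
theorem conj_single_eq_of_mul_eq (u' : (mixedSpace K)ˣ) (x : mixedSpace K) (hx : (u' : mixedSpace K) * x = x)
    (hx' : x * (u' : mixedSpace K)⁻¹ = x) (i j : Fin 2) :
    ((diagGL2 u' 1 : GL (Fin 2) (mixedSpace K)) : Matrix (Fin 2) (Fin 2) (mixedSpace K)) * Matrix.single i j x *
        (((diagGL2 u' 1)⁻¹ : GL (Fin 2) (mixedSpace K)) : Matrix (Fin 2) (Fin 2) (mixedSpace K)) =
      Matrix.single i j x := by
  have hinv : ((diagGL2 u' 1)⁻¹ : GL (Fin 2) (mixedSpace K)) = diagGL2 u'⁻¹ 1 := by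
    rw [eq_comm, ← mul_eq_one_iff_eq_inv, ← diagGL2_one_mul, inv_mul_cancel]
    exact Units.ext (by rw [coe_diagGL2_one]; simp)
  have e1 : ((diagGL2 u' 1 : GL (Fin 2) (mixedSpace K)) : Matrix (Fin 2) (Fin 2) (mixedSpace K)) =
      Matrix.diagonal fun k => ((![u', 1] k : (mixedSpace K)ˣ) : mixedSpace K) := coe_glDiagonal 2 (mixedSpace K) ![u', 1]
  have e2 : ((diagGL2 u'⁻¹ 1 : GL (Fin 2) (mixedSpace K)) : Matrix (Fin 2) (Fin 2) (mixedSpace K)) =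
      Matrix.diagonal fun k => ((![u'⁻¹, 1] k : (mixedSpace K)ˣ) : mixedSpace K) := coe_glDiagonal 2 (mixedSpace K) ![u'⁻¹, 1]
  rw [hinv, e1, e2]
  refine Matrix.ext fun a b => ?_
  rw [Matrix.mul_diagonal, Matrix.diagonal_mul, Matrix.single_apply]
  fin_cases i <;> fin_cases j <;> fin_cases a <;> fin_cases b <;> simp [hx, hx']

omit [NumberField K] in
/-- **Real place:** if the `w`-coordinate of `u'` is `1` then `Ad(diag(u',1))` fixes `E_{ij} ⊗ r_w`. [folklore] -/
theorem conj_single_realIdem_eq (w : {w : InfinitePlace K // IsReal w}) (u' : (mixedSpace K)ˣ)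
    (hu' : (u' : mixedSpace K).1 w = 1) (i j : Fin 2) :
    ((diagGL2 u' 1 : GL (Fin 2) (mixedSpace K)) : Matrix (Fin 2) (Fin 2) (mixedSpace K)) *
        Matrix.single i j ((Pi.single w 1, 0) : mixedSpace K) *
        (((diagGL2 u' 1)⁻¹ : GL (Fin 2) (mixedSpace K)) : Matrix (Fin 2) (Fin 2) (mixedSpace K)) =
      Matrix.single i j ((Pi.single w 1, 0) : mixedSpace K) := by
  refine conj_single_eq_of_mul_eq u' _ ?_ ?_ i j
  · refine Prod.ext (funext fun v => ?_) (by simp)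
    simp only [Prod.fst_mul, Pi.mul_apply]
    by_cases hv : v = w
    · subst hv; simp [hu']
    · simp [hv]
  · refine Prod.ext (funext fun v => ?_) (by simp)
    by_cases hv : v = w
    · subst hv; simp [hu']
    · simp [hv]

omit [NumberField K] in
/-- **Complex place:** if the `w`-coordinate of `u'` is `1` then `Ad(diag(u',1))` fixes `E_{ij} ⊗ (a 1_w)` for
every `a ∈ ℂ` (in particular `E_{ij} ⊗ c_w`, `E_{ij} ⊗ ic_w`). [folklore] -/
theorem conj_single_complexIdem_eq (w : {w : InfinitePlace K // IsComplex w}) (u' : (mixedSpace K)ˣ)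
    (hu' : (u' : mixedSpace K).2 w = 1) (a : ℂ) (i j : Fin 2) :
    ((diagGL2 u' 1 : GL (Fin 2) (mixedSpace K)) : Matrix (Fin 2) (Fin 2) (mixedSpace K)) *
        Matrix.single i j ((0, Pi.single w a) : mixedSpace K) *
        (((diagGL2 u' 1)⁻¹ : GL (Fin 2) (mixedSpace K)) : Matrix (Fin 2) (Fin 2) (mixedSpace K)) =
      Matrix.single i j ((0, Pi.single w a) : mixedSpace K) := by
  refine conj_single_eq_of_mul_eq u' _ ?_ ?_ i j
  · refine Prod.ext (by simp) (funext fun v => ?_)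
    simp only [Prod.snd_mul, Pi.mul_apply]
    by_cases hv : v = w
    · subst hv; simp [hu']
    · simp [hv]
  · refine Prod.ext (by simp) (funext fun v => ?_)
    by_cases hv : v = w
    · subst hv; simp [hu']
    · simp [hv]

end Conj

end Literature.NumberTheory.Automorphic
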